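import Summits.QuantumFields.QCD.Theorems.HeatSlicedQuarksQuarkLoopCoefficientFreeHeatCalculusAux
import Summits.QuantumFields.QCD.Theorems.HeatSlicedQuarksQuarkLoopCoefficientSecondOrderCoefficientAuxE

/-!
# Free heat calculus on `ℤ⁴`, part B: the free symbol as a trigonometric polynomial
(line `Sketch` of crux stmt-QuantumFields-16786, helper file of the stub `stub_freeHeatCalculus`)

* bounds `0 ≤ h(p) ≤ 68` of the free Wilson symbol `hsymb`;
* the trigonometric identity `h(p) = 20 − 8 Σ cos p_μ + Σ_{μ ≠ ν} cos p_μ cos p_ν = Σ_z ĥ(z) e^{−ip·z}`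
  (`hsymb_eq_sum_cexp`, from the `33`-term expansion of part A);
* its consequences `h(p) e^{ip·w} = Σ_z ĥ(z) e^{ip·(w−z)}` and
  `h(p) cos(p·w) = Σ_{z ∈ nbr2 0} ĥ(z) cos(p·(w − z))` (`hsymb_mul_cos`), the Fourier-side form of the
  lattice heat equation `∂_t k_t = −ĥ ∗ k_t`.
-/

noncomputable section

namespace Summit.QuantumFields.QCD.Cruxes.QuarkLoopCoefficient.Sketch.FreeHeatCalculus

open Literature.MathematicalPhysics.QuantumLattice Literature.MathematicalPhysics.QuantumFieldTheory
open Literature.Probability.LatticeModels (Site)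
open Summit.QuantumFields.QCD.Theorems.QuarkLoopCoefficient
open Summit.QuantumFields.QCD.Cruxes.QuarkLoopCoefficient.Sketch.HeatSeries
open scoped Matrix ComplexConjugate
-- Brillouin-zone and symbol basics reused from the landed `…SecondOrderCoefficientAuxE`.
open Summit.QuantumFields.QCD.Cruxes.QuarkLoopCoefficient.Sketch.SecondOrderCoefficient
  (hsymb_nonneg continuous_hsymb measurableSet_brillouin isCompact_brillouin volume_brillouin_lt_top)

/-! ## The free symbol -/

/-- `h(p) ≤ 68` (`Σ sin² ≤ 4`, `(Σ (1 − cos))² ≤ 64`). -/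
theorem hsymb_le (p : Fin 4 → ℝ) : hsymb p ≤ 68 := by
  unfold hsymb
  have h1 : ∑ μ : Fin 4, Real.sin (p μ) ^ 2 ≤ ∑ _μ : Fin 4, (1 : ℝ) :=
    Finset.sum_le_sum fun μ _ => by rw [sq_le_one_iff_abs_le_one]; exact Real.abs_sin_le_one _
  have h2 : |∑ μ : Fin 4, (1 - Real.cos (p μ))| ≤ ∑ _μ : Fin 4, (2 : ℝ) := by
    refine (Finset.abs_sum_le_sum_abs _ _).trans (Finset.sum_le_sum fun μ _ => ?_)
    have := Real.abs_cos_le_one (p μ)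
    rw [abs_le] at this ⊢
    constructor <;> linarith [this.1, this.2]
  have h3 : (∑ μ : Fin 4, (1 - Real.cos (p μ))) ^ 2 ≤ 8 ^ 2 := by
    rw [← sq_abs]
    have h8 : ∑ _μ : Fin 4, (2 : ℝ) = 8 := by simp; norm_num
    rw [h8] at h2
    exact pow_le_pow_left₀ (abs_nonneg _) h2 2
  have h4 : ∑ _μ : Fin 4, (1 : ℝ) = 4 := by simp
  linarith

/-- Removing the diagonal from a double sum over `Fin 4`. -/
theorem sum_ite_diag_zero (g : Fin 4 → ℝ) (μ : Fin 4) :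
    ∑ ν : Fin 4, (if μ = ν then 0 else g ν) = ∑ ν : Fin 4, g ν - g μ := by
  calc ∑ ν : Fin 4, (if μ = ν then 0 else g ν)
      = ∑ ν : Fin 4, (g ν - if μ = ν then g ν else 0) :=
        Finset.sum_congr rfl fun ν _ => by split_ifs <;> simp
    _ = ∑ ν : Fin 4, g ν - ∑ ν : Fin 4, (if μ = ν then g ν else 0) := Finset.sum_sub_distrib _ _
    _ = ∑ ν : Fin 4, g ν - g μ := by rw [Finset.sum_ite_eq]; simp

/-- The expanded form of the free symbol:
`h(p) = 20 − 8 Σ_μ cos p_μ + Σ_{μ ≠ ν} cos p_μ cos p_ν`. -/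
theorem hsymb_expand (p : Fin 4 → ℝ) :
    hsymb p = 20 - 8 * ∑ μ : Fin 4, Real.cos (p μ) +
      ∑ μ : Fin 4, ∑ ν : Fin 4, (if μ = ν then 0 else Real.cos (p μ) * Real.cos (p ν)) := by
  have h1 : ∑ μ : Fin 4, Real.sin (p μ) ^ 2 = 4 - ∑ μ : Fin 4, Real.cos (p μ) ^ 2 := by
    simp_rw [Real.sin_sq]
    rw [Finset.sum_sub_distrib]
    simp
  have h2 : ∑ μ : Fin 4, (1 - Real.cos (p μ)) = 4 - ∑ μ : Fin 4, Real.cos (p μ) := by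
    rw [Finset.sum_sub_distrib]
    simp
  have h3 : ∑ μ : Fin 4, ∑ ν : Fin 4, (if μ = ν then 0 else Real.cos (p μ) * Real.cos (p ν)) =
      (∑ μ : Fin 4, Real.cos (p μ)) * (∑ μ : Fin 4, Real.cos (p μ)) - ∑ μ : Fin 4, Real.cos (p μ) ^ 2 := by
    rw [Finset.sum_mul_sum, ← Finset.sum_sub_distrib]
    refine Finset.sum_congr rfl fun μ _ => ?_
    rw [sum_ite_diag_zero (fun ν => Real.cos (p μ) * Real.cos (p ν)) μ, sq]
  unfold hsymb
  rw [h1, h2, h3]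
  ring

/-- The lattice dot product `p · z` is additive in `z`. -/
theorem dot_add (p : Fin 4 → ℝ) (v w : Site 4) :
    ∑ μ : Fin 4, p μ * (((v + w) μ : ℤ) : ℝ) =
      ∑ μ : Fin 4, p μ * ((v μ : ℤ) : ℝ) + ∑ μ : Fin 4, p μ * ((w μ : ℤ) : ℝ) := by
  rw [← Finset.sum_add_distrib]
  refine Finset.sum_congr rfl fun μ _ => ?_
  rw [Pi.add_apply, Int.cast_add, mul_add]

/-- The lattice dot product is odd in `z`. -/
theorem dot_neg (p : Fin 4 → ℝ) (w : Site 4) :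
    ∑ μ : Fin 4, p μ * (((-w) μ : ℤ) : ℝ) = -∑ μ : Fin 4, p μ * ((w μ : ℤ) : ℝ) := by
  rw [← Finset.sum_neg_distrib]
  refine Finset.sum_congr rfl fun μ _ => ?_
  rw [Pi.neg_apply, Int.cast_neg, mul_neg]

/-- The lattice dot product is subtractive in `z`. -/
theorem dot_sub (p : Fin 4 → ℝ) (v w : Site 4) :
    ∑ μ : Fin 4, p μ * (((v - w) μ : ℤ) : ℝ) =
      ∑ μ : Fin 4, p μ * ((v μ : ℤ) : ℝ) - ∑ μ : Fin 4, p μ * ((w μ : ℤ) : ℝ) := by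
  rw [sub_eq_add_neg, dot_add, dot_neg, ← sub_eq_add_neg]

/-- `p · e_μ = p_μ`. -/
theorem dot_single (p : Fin 4 → ℝ) (μ : Fin 4) :
    ∑ ν : Fin 4, p ν * (((Pi.single μ (1 : ℤ) : Site 4) ν : ℤ) : ℝ) = p μ := by
  simp [Pi.single_apply]

/-- `p · 0 = 0`. -/
theorem dot_zero (p : Fin 4 → ℝ) : ∑ ν : Fin 4, p ν * (((0 : Site 4) ν : ℤ) : ℝ) = 0 := by
  simp

/-- `e^{−ia} + e^{ia} = 2 cos a` in `ℂ`, for real `a`. -/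
theorem cexp_neg_add_cexp (a : ℝ) :
    Complex.exp (-((a : ℂ) * Complex.I)) + Complex.exp ((a : ℂ) * Complex.I) =
      2 * ((Real.cos a : ℝ) : ℂ) := by
  rw [Complex.ofReal_cos, Complex.cos, ← neg_mul]
  ring

/-- The expanded free symbol, cast to `ℂ`. -/
theorem hsymb_expand_complex (p : Fin 4 → ℝ) :
    ((hsymb p : ℝ) : ℂ) = 20 - 8 * ∑ μ : Fin 4, ((Real.cos (p μ) : ℝ) : ℂ) +
      ∑ μ : Fin 4, ∑ ν : Fin 4,
        (if μ = ν then (0 : ℂ) else ((Real.cos (p μ) : ℝ) : ℂ) * ((Real.cos (p ν) : ℝ) : ℂ)) := by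
  rw [hsymb_expand]
  push_cast
  congr 1
  refine Finset.sum_congr rfl fun μ _ => Finset.sum_congr rfl fun ν _ => ?_
  split_ifs <;> simp

/-- **The free symbol as a trigonometric polynomial**:
`h(p) = Σ_{z ∈ nbr2 0} ĥ(z) e^{−i p·z}`. -/
theorem hsymb_eq_sum_cexp (p : Fin 4 → ℝ) :
    ((hsymb p : ℝ) : ℂ) = ∑ z ∈ nbr2 0, ((hhat z : ℝ) : ℂ) *
      Complex.exp (-(((∑ μ : Fin 4, p μ * ((z μ : ℤ) : ℝ) : ℝ) : ℂ) * Complex.I)) := by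
  have hsm : ∀ z : Site 4, ((hhat z : ℝ) : ℂ) *
      Complex.exp (-(((∑ μ : Fin 4, p μ * ((z μ : ℤ) : ℝ) : ℝ) : ℂ) * Complex.I)) =
      hhat z • Complex.exp (-(((∑ μ : Fin 4, p μ * ((z μ : ℤ) : ℝ) : ℝ) : ℂ) * Complex.I)) :=
    fun z => (Complex.real_smul).symm
  simp_rw [hsm]
  rw [sum_nbr2_hhat_smul]
  simp only [dot_add, dot_sub, dot_neg, dot_single, dot_zero]
  -- assemble the cosines
  have e1 : ∀ μ : Fin 4, Complex.exp (-(((p μ : ℝ) : ℂ) * Complex.I)) +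
      Complex.exp (-(((-p μ : ℝ) : ℂ) * Complex.I)) = 2 * ((Real.cos (p μ) : ℝ) : ℂ) := by
    intro μ
    rw [← cexp_neg_add_cexp]
    push_cast
    ring_nf
  have e2 : ∀ μ ν : Fin 4,
      Complex.exp (-(((p μ + p ν : ℝ) : ℂ) * Complex.I)) + Complex.exp (-(((p μ - p ν : ℝ) : ℂ) * Complex.I)) +
        Complex.exp (-(((-p μ + p ν : ℝ) : ℂ) * Complex.I)) + Complex.exp (-(((-p μ - p ν : ℝ) : ℂ) * Complex.I)) =
      4 * (((Real.cos (p μ) : ℝ) : ℂ) * ((Real.cos (p ν) : ℝ) : ℂ)) := by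
    intro μ ν
    have h4 : 4 * (((Real.cos (p μ) : ℝ) : ℂ) * ((Real.cos (p ν) : ℝ) : ℂ)) =
        2 * ((Real.cos (p μ + p ν) : ℝ) : ℂ) + 2 * ((Real.cos (p μ - p ν) : ℝ) : ℂ) := by
      rw [Real.cos_add, Real.cos_sub]; push_cast; ring
    rw [h4, ← cexp_neg_add_cexp, ← cexp_neg_add_cexp]
    push_cast
    ring_nf
  simp only [e1, e2, Complex.ofReal_zero, zero_mul, neg_zero, Complex.exp_zero]
  rw [hsymb_expand_complex]
  have s1 : ∑ μ : Fin 4, (2 : ℂ) * ((Real.cos (p μ) : ℝ) : ℂ) = 2 * ∑ μ : Fin 4, ((Real.cos (p μ) : ℝ) : ℂ) := by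
    rw [Finset.mul_sum]
  have s2 : ∑ μ : Fin 4, ∑ ν : Fin 4,
      (if μ = ν then (0 : ℂ) else 4 * (((Real.cos (p μ) : ℝ) : ℂ) * ((Real.cos (p ν) : ℝ) : ℂ))) =
      4 * ∑ μ : Fin 4, ∑ ν : Fin 4,
        (if μ = ν then (0 : ℂ) else ((Real.cos (p μ) : ℝ) : ℂ) * ((Real.cos (p ν) : ℝ) : ℂ)) := by
    rw [Finset.mul_sum]
    refine Finset.sum_congr rfl fun μ _ => ?_
    rw [Finset.mul_sum]
    refine Finset.sum_congr rfl fun ν _ => ?_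
    split_ifs <;> simp
  rw [s1, s2]
  simp only [Complex.real_smul]
  push_cast
  ring

/-- **The free symbol acting on a plane wave**:
`h(p) e^{i p·w} = Σ_{z ∈ nbr2 0} ĥ(z) e^{i p·(w − z)}`. -/
theorem hsymb_mul_cexp (p : Fin 4 → ℝ) (w : Site 4) :
    ((hsymb p : ℝ) : ℂ) * Complex.exp (((∑ μ : Fin 4, p μ * ((w μ : ℤ) : ℝ) : ℝ) : ℂ) * Complex.I) =
      ∑ z ∈ nbr2 0, ((hhat z : ℝ) : ℂ) *
        Complex.exp (((∑ μ : Fin 4, p μ * (((w - z) μ : ℤ) : ℝ) : ℝ) : ℂ) * Complex.I) := by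
  rw [hsymb_eq_sum_cexp, Finset.sum_mul]
  refine Finset.sum_congr rfl fun z _ => ?_
  rw [dot_sub, mul_assoc, ← Complex.exp_add]
  congr 2
  push_cast
  ring

/-- **The Fourier-side heat equation identity**:
`h(p) cos(p·w) = Σ_{z ∈ nbr2 0} ĥ(z) cos(p·(w − z))`. -/
theorem hsymb_mul_cos (p : Fin 4 → ℝ) (w : Site 4) :
    hsymb p * Real.cos (∑ μ : Fin 4, p μ * ((w μ : ℤ) : ℝ)) =
      ∑ z ∈ nbr2 0, hhat z * Real.cos (∑ μ : Fin 4, p μ * (((w - z) μ : ℤ) : ℝ)) := by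
  have h := congrArg Complex.re (hsymb_mul_cexp p w)
  rw [Complex.re_ofReal_mul, Complex.exp_ofReal_mul_I_re, Complex.re_sum] at h
  rw [h]
  refine Finset.sum_congr rfl fun z _ => ?_
  rw [Complex.re_ofReal_mul, Complex.exp_ofReal_mul_I_re]

/-! ## Registered headline -/

/-- Registered headline of this helper file (aux stub `stub_freeHeatCalculusAuxB` of crux
stmt-QuantumFields-16786, line `Sketch`): the Fourier-side heat equation identity of the free symbol. -/
theorem stub_freeHeatCalculusAuxB :
    ∀ (p : Fin 4 → ℝ) (w : Site 4),
      hsymb p * Real.cos (∑ μ : Fin 4, p μ * ((w μ : ℤ) : ℝ)) =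
        ∑ z ∈ nbr2 0, hhat z * Real.cos (∑ μ : Fin 4, p μ * (((w - z) μ : ℤ) : ℝ)) :=
  hsymb_mul_cos

end Summit.QuantumFields.QCD.Cruxes.QuarkLoopCoefficient.Sketch.FreeHeatCalculus

end
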